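import Mathlib
import Summits.Ventures.HodgeRepro.Tier4.Common.CocompactBridge
import Summits.Ventures.HodgeRepro.Tier4.Common.SettingOfData
import Summits.Ventures.HodgeRepro.Tier4.Line1.TorusCocompact
import Summits.Ventures.HodgeRepro.Tier4.Line1.LocallyCompactGA
import Summits.Ventures.HodgeRepro.Tier4.Line1.DefinedContentOfData
import Summits.Ventures.HodgeRepro.Tier4.Line1.CMQuadData
import Summits.Ventures.HodgeRepro.Tier4.Line1.QuotientCompact
import Summits.Ventures.HodgeRepro.Tier4.Line1.RTFDataOfCharacters

/-!
# Tier4/Line1/CMDefinedContent — the DEFINED half of LINE L1's RTF datum ON THE CM FIELD OF THE TARGET: torus data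
from characters, a Haar measure, and the relative-trace-formula output on the CM seesaw plane

Blind re-derivation cell `pub-hodge-repro`, Tier 4 (README §9–§10), seat t4-L1-p3 (gen 2).  Target tree path
`lean/Summits/Ventures/HodgeRepro/Tier4/Line1/CMDefinedContent.lean`.  Imports typer-2's `Common.CocompactBridge`
(`IsCocompactRational`, `exists_rtfData_isHaar_closure`) and `Common.SettingOfData`, t4-L1-p5's
`Line1.TorusCocompact` (`cocompact_rationalOf_torusT` / `torusT'`) and `Line1.LocallyCompactGA`, and this seat's
`Line1.DefinedContentOfData` (`exists_periods_ofData`) and `Line1.CMQuadData` (`cmQuad`,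
`isDefinite_isGenuineRow_ofLinesRow_cmQuad`).

WHAT THIS IS — the (I0) construction of the costume `line1_realise` (Skeleton v0.31 L1226), DEFINED half, assembled
on the concrete field: for the CM field `E` of `P_T4` with `k = E⁺`,
* `isCocompactRational_torusT` / `torusT'`: the tori of a definite genuine plane are cocompact in typer-2's named form
  (p5's (I1-c′)/(I1-c″) ARE `IsCocompactRational` by definition);
* `exists_rtfData_of_chars`: from two continuous characters `χ` of `T(𝔸)`, `χ′` of `T′(𝔸)` — multiplicative, trivial
  on the rational points, equal on the centre (N2) — an `RTFData` with these characters, Haar torus measures and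
  relatively compact measurable fundamental domains (the domains `DT`, `DT′` of the datum are no longer inputs);
* `haar_GA`: a Haar measure on `U(W)(𝔸_k)` (Mathlib's `Measure.haar` on the locally compact group, p5's
  `locallyCompact_GA`);
* `exists_periods_cm`: the relative-trace-formula output of `DefinedContentOfData` on the CM seesaw plane
  `ofLinesRow (cmQuad ω h) a b 1` — for line scalars `a, b ∈ E⁺` of one sign at a real embedding `σ`, any `RTFData`
  with continuous unitary characters, any Haar measure and any relatively compact fundamental domain `DG` of
  `U(W)(k)`: an invariant subspace `τ m` of `L²(DG)`, hit by `f̄₁`, carrying BOTH toric functionals.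
The binders of `exists_periods_cm` are EXACTLY what the DEFINED half of the costume still takes from outside:
the plane parameters `(ω, a, b, σ)` (which ones are Liu 2021 Lemma D.2(2)'s is the identification, free half), the
characters `χ, χ′` with N2 (the corner characters through the printed identification, free half), and the
cocompactness datum `DG` ((I1-c), t4-L1-p5's `quotient_compact_genuine` — by name when it serves).  Nothing here
touches the free pins, the lift `F1 + F2` or the seesaw (S1)–(S3).  Nothing here says anything about the status of
the Hodge conjecture for CM abelian varieties, which is NOT proved (HC_CM is NOT proved by anyone in this repository).
-/

set_option autoImplicit false

noncomputable section

namespace Summit.Ventures.HodgeRepro.Tier4.Line1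

open NumberField Common MeasureTheory Topology

section TorusData

variable {k : Type} [Field k] [NumberField k] (W : PlaneData k)

/-- **The torus `T` of a definite genuine plane is cocompact** in typer-2's named form: p5's (I1-c′)
`cocompact_rationalOf_torusT` IS `IsCocompactRational W (torusT W)` by definition. -/
theorem isCocompactRational_torusT (hW : IsDefinite W) (hg : IsGenuineRow W) :
    IsCocompactRational W (torusT W) :=
  cocompact_rationalOf_torusT W hg hW

/-- **The torus `T′` of a definite genuine plane is cocompact** (p5's (I1-c″)). -/
theorem isCocompactRational_torusT' (hW : IsDefinite W) (hg : IsGenuineRow W) :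
    IsCocompactRational W (torusT' W) :=
  cocompact_rationalOf_torusT' W hg hW

variable [MeasurableSpace (GA W)] [BorelSpace (GA W)]

/-- **The RTF torus data from the characters alone** (the costume's `R`): for a definite genuine plane and two
characters `χ`, `χ′` of the adelic tori — multiplicative, trivial on the rational points, matching on the centre
(N2) — there is an `RTFData` with these characters whose torus measures are Haar and whose fundamental domains are
measurable with compact closure (typer-2's `exists_rtfData_isHaar_closure` on p5's cocompactness). -/
theorem exists_rtfData_of_chars (hW : IsDefinite W) (hg : IsGenuineRow W)
    (chi : torusT W → ℂ) (chi' : torusT' W → ℂ)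
    (chi_mul : ∀ s t : torusT W, chi (s * t) = chi s * chi t)
    (chi'_mul : ∀ s t : torusT' W, chi' (s * t) = chi' s * chi' t)
    (chi_rational : ∀ t : torusT W, (t : GA W) ∈ rationalPoints W → chi t = 1)
    (chi'_rational : ∀ t : torusT' W, (t : GA W) ∈ rationalPoints W → chi' t = 1)
    (chi_centre : ∀ (z : GA W) (hz : z ∈ centre W),
      chi ⟨z, centre_le_torusT W hz⟩ = chi' ⟨z, centre_le_torusT' W hz⟩) :
    ∃ R : RTFData W, R.chi = chi ∧ R.chi' = chi' ∧ R.IsHaar ∧ MeasurableSet R.DT ∧ MeasurableSet R.DT' ∧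
      IsCompact (closure R.DT) ∧ IsCompact (closure R.DT') :=
  exists_rtfData_isHaar_closure W chi chi' chi_mul chi'_mul chi_rational chi'_rational chi_centre
    (isCocompactRational_torusT W hW hg) (isCocompactRational_torusT' W hW hg)

/-- **A Haar measure on `U(W)(𝔸_k)`** (Mathlib's `Measure.haar` on the locally compact group `GA W`). -/
def haar_GA : Measure (GA W) :=
  haveI := locallyCompact_GA W
  Measure.haar

/-- `haar_GA` is a Haar measure. -/
theorem haar_GA_isHaarMeasure : (haar_GA W).IsHaarMeasure := by
  haveI := locallyCompact_GA W
  unfold haar_GA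
  infer_instance

end TorusData

section CM

variable {E : Type} [Field E] [NumberField E] [IsCMField E]

/-- **THE RELATIVE-TRACE-FORMULA OUTPUT ON THE CM SEESAW PLANE** (the DEFINED half of `line1_realise`'s RTF datum,
assembled): for the CM field `E`, a purely imaginary `ω`, line scalars `a, b ∈ E⁺` of one sign at a real embedding
`σ`, an `RTFData` with continuous unitary characters on the plane `⟨a⟩ ⊕ ⟨b⟩`, a Haar measure `μ` and a relatively
compact fundamental domain `DG` of `U(W)(k)`: an adapted orthonormal family and an invariant subspace `τ m` of
`L²(DG)`, hit by the test function `f̄₁`, on which BOTH toric functionals `PeriodNonzeroT χ`, `PeriodNonzeroT′ χ′`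
are non-zero. -/
theorem exists_periods_cm (ω : E) (hω : ω ≠ 0) (h : IsCMField.complexConj E ω = -ω)
    (a b : maximalRealSubfield E) (ha : a ≠ 0) (hb : b ≠ 0) (σ : maximalRealSubfield E →+* ℝ)
    (hpos : (0 < σ a ∧ 0 < σ b) ∨ (σ a < 0 ∧ σ b < 0))
    [MeasurableSpace (GA (PlaneData.ofLinesRow (cmQuad ω h) a b 1))]
    [BorelSpace (GA (PlaneData.ofLinesRow (cmQuad ω h) a b 1))]
    (R : RTFData (PlaneData.ofLinesRow (cmQuad ω h) a b 1))
    (μ : Measure (GA (PlaneData.ofLinesRow (cmQuad ω h) a b 1))) [μ.IsHaarMeasure]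
    [R.μT.IsHaarMeasure] [R.μT'.IsHaarMeasure]
    (DG : Set (GA (PlaneData.ofLinesRow (cmQuad ω h) a b 1)))
    (fdG : IsFundamentalDomain (rationalPoints (PlaneData.ofLinesRow (cmQuad ω h) a b 1)) DG μ)
    (compG : IsCompact (closure DG)) (hT : IsCompact (closure R.DT)) (hT' : IsCompact (closure R.DT'))
    (hc : Continuous R.chi) (hu : ∀ x, ‖R.chi x‖ = 1) (hc' : Continuous R.chi') (hu' : ∀ x, ‖R.chi' x‖ = 1) :
    ∃ (τ : ℕ → Set (GA (PlaneData.ofLinesRow (cmQuad ω h) a b 1) → ℂ))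
      (φ : ℕ → GA (PlaneData.ofLinesRow (cmQuad ω h) a b 1) → ℂ) (n : ℕ → ℕ)
      (f₁ : GA (PlaneData.ofLinesRow (cmQuad ω h) a b 1) → ℂ) (m : ℕ),
      (Setting.ofAdelicData (PlaneData.ofLinesRow (cmQuad ω h) a b 1) R μ DG fdG compG hT hT').IsAdaptedONB τ φ n ∧
      RTF.IsTest f₁ ∧
      (Setting.ofAdelicData (PlaneData.ofLinesRow (cmQuad ω h) a b 1) R μ DG fdG compG hT hT').PeriodNonzeroT
        R.chi (τ m) ∧
      (Setting.ofAdelicData (PlaneData.ofLinesRow (cmQuad ω h) a b 1) R μ DG fdG compG hT hT').PeriodNonzeroT'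
        R.chi' (τ m) ∧
      (Setting.ofAdelicData (PlaneData.ofLinesRow (cmQuad ω h) a b 1) R μ DG fdG compG hT hT').Hit
        (RTF.cj f₁) (τ m) :=
  exists_periods_ofData (PlaneData.ofLinesRow (cmQuad ω h) a b 1) R μ DG fdG compG hT hT'
    (isDefinite_isGenuineRow_ofLinesRow_cmQuad ω hω h a b ha hb σ hpos).1
    (isDefinite_isGenuineRow_ofLinesRow_cmQuad ω hω h a b ha hb σ hpos).2 hc hu hc' hu'

end CM

/-! ## v0.2 (append, 2026-08-28T23:2xZ): the cocompactness datum `DG` and the RTF data DISCHARGED BY NAME — t4-L1-p5's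
`quotient_compact_genuine` (QuotientCompact, (I1-c) with `IsDefinite ∧ IsGenuineRow`) and t4-L1-p4's
`RTFData.ofCharacters` (RTFDataOfCharacters, (I0-R)); the binders of the DEFINED half are then EXACTLY the plane, the two
characters with their seven clauses, and their continuity / unitarity. -/

section ByName

variable {k : Type} [Field k] [NumberField k] (W : PlaneData k) [MeasurableSpace (GA W)] [BorelSpace (GA W)]

/-- **THE RELATIVE-TRACE-FORMULA OUTPUT FROM THE CHARACTERS ALONE** (every cocompactness datum by name): for a
definite genuine plane, a Haar measure `μ` on `U(W)(𝔸_k)` and two characters `χ`, `χ′` of the adelic tori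
(multiplicative, trivial on the rational points, matching on the centre — N2 —, continuous, unitary), with the RTF
data `RTFData.ofCharacters` (p4) and SOME relatively compact fundamental domain `DG` of `U(W)(k)` (p5's
`quotient_compact_genuine`): an adapted orthonormal family and an invariant subspace `τ m` of `L²(DG)`, hit by `f̄₁`,
carrying BOTH toric functionals. -/
theorem exists_periods_ofCharacters (hW : IsDefinite W) (hg : IsGenuineRow W) (μ : Measure (GA W))
    [μ.IsHaarMeasure] (chi : torusT W → ℂ) (chi' : torusT' W → ℂ)
    (hmul : ∀ s t : torusT W, chi (s * t) = chi s * chi t)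
    (hmul' : ∀ s t : torusT' W, chi' (s * t) = chi' s * chi' t)
    (hrat : ∀ t : torusT W, (t : GA W) ∈ rationalPoints W → chi t = 1)
    (hrat' : ∀ t : torusT' W, (t : GA W) ∈ rationalPoints W → chi' t = 1)
    (hcentre : ∀ (z : GA W) (hz : z ∈ centre W),
      chi ⟨z, centre_le_torusT W hz⟩ = chi' ⟨z, centre_le_torusT' W hz⟩)
    (hc : Continuous chi) (hu : ∀ x, ‖chi x‖ = 1) (hc' : Continuous chi') (hu' : ∀ x, ‖chi' x‖ = 1) :
    haveI := ofCharacters_μT_isHaarMeasure W hW hg chi chi' hmul hmul' hrat hrat' hcentre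
    haveI := ofCharacters_μT'_isHaarMeasure W hW hg chi chi' hmul hmul' hrat hrat' hcentre
    ∃ (DG : Set (GA W)) (fdG : IsFundamentalDomain (rationalPoints W) DG μ) (compG : IsCompact (closure DG))
      (τ : ℕ → Set (GA W → ℂ)) (φ : ℕ → GA W → ℂ) (n : ℕ → ℕ) (f₁ : GA W → ℂ) (m : ℕ),
      (Setting.ofAdelicData W (RTFData.ofCharacters W hW hg chi chi' hmul hmul' hrat hrat' hcentre) μ DG fdG compG
        (ofCharacters_hT W hW hg chi chi' hmul hmul' hrat hrat' hcentre)
        (ofCharacters_hT' W hW hg chi chi' hmul hmul' hrat hrat' hcentre)).IsAdaptedONB τ φ n ∧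
      RTF.IsTest f₁ ∧
      (Setting.ofAdelicData W (RTFData.ofCharacters W hW hg chi chi' hmul hmul' hrat hrat' hcentre) μ DG fdG compG
        (ofCharacters_hT W hW hg chi chi' hmul hmul' hrat hrat' hcentre)
        (ofCharacters_hT' W hW hg chi chi' hmul hmul' hrat hrat' hcentre)).PeriodNonzeroT chi (τ m) ∧
      (Setting.ofAdelicData W (RTFData.ofCharacters W hW hg chi chi' hmul hmul' hrat hrat' hcentre) μ DG fdG compG
        (ofCharacters_hT W hW hg chi chi' hmul hmul' hrat hrat' hcentre)
        (ofCharacters_hT' W hW hg chi chi' hmul hmul' hrat hrat' hcentre)).PeriodNonzeroT' chi' (τ m) ∧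
      (Setting.ofAdelicData W (RTFData.ofCharacters W hW hg chi chi' hmul hmul' hrat hrat' hcentre) μ DG fdG compG
        (ofCharacters_hT W hW hg chi chi' hmul hmul' hrat hrat' hcentre)
        (ofCharacters_hT' W hW hg chi chi' hmul hmul' hrat hrat' hcentre)).Hit (RTF.cj f₁) (τ m) := by
  haveI := ofCharacters_μT_isHaarMeasure W hW hg chi chi' hmul hmul' hrat hrat' hcentre
  haveI := ofCharacters_μT'_isHaarMeasure W hW hg chi chi' hmul hmul' hrat hrat' hcentre
  obtain ⟨DG, fdG, compG⟩ := quotient_compact_genuine W hW hg μ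
  refine ⟨DG, fdG, compG, ?_⟩
  exact exists_periods_ofData W (RTFData.ofCharacters W hW hg chi chi' hmul hmul' hrat hrat' hcentre) μ DG fdG compG
    (ofCharacters_hT W hW hg chi chi' hmul hmul' hrat hrat' hcentre)
    (ofCharacters_hT' W hW hg chi chi' hmul hmul' hrat hrat' hcentre) hW hg hc hu hc' hu'

end ByName

section CMByName

variable {E : Type} [Field E] [NumberField E] [IsCMField E]

/-- **THE DEFINED HALF OF `line1_realise`'s RTF DATUM ON THE CM FIELD, with binders = the plane parameters and the
characters only**: for the CM field `E`, `ω` purely imaginary, line scalars `a, b ∈ E⁺` of one sign at `σ`, a Haar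
measure and two continuous unitary characters of the tori of the CM seesaw plane with the seven clauses — the RTF output
`∃ DG τ φ n f₁ m, …` of `exists_periods_ofCharacters`, the plane's `IsDefinite ∧ IsGenuineRow` supplied by
`isDefinite_isGenuineRow_ofLinesRow_cmQuad`. -/
theorem exists_periods_cm_ofCharacters (ω : E) (hω : ω ≠ 0) (h : IsCMField.complexConj E ω = -ω)
    (a b : maximalRealSubfield E) (ha : a ≠ 0) (hb : b ≠ 0) (σ : maximalRealSubfield E →+* ℝ)
    (hpos : (0 < σ a ∧ 0 < σ b) ∨ (σ a < 0 ∧ σ b < 0))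
    [MeasurableSpace (GA (PlaneData.ofLinesRow (cmQuad ω h) a b 1))]
    [BorelSpace (GA (PlaneData.ofLinesRow (cmQuad ω h) a b 1))]
    (μ : Measure (GA (PlaneData.ofLinesRow (cmQuad ω h) a b 1))) [μ.IsHaarMeasure]
    (chi : torusT (PlaneData.ofLinesRow (cmQuad ω h) a b 1) → ℂ)
    (chi' : torusT' (PlaneData.ofLinesRow (cmQuad ω h) a b 1) → ℂ)
    (hmul : ∀ s t, chi (s * t) = chi s * chi t) (hmul' : ∀ s t, chi' (s * t) = chi' s * chi' t)
    (hrat : ∀ t : torusT (PlaneData.ofLinesRow (cmQuad ω h) a b 1),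
      (t : GA (PlaneData.ofLinesRow (cmQuad ω h) a b 1)) ∈ rationalPoints (PlaneData.ofLinesRow (cmQuad ω h) a b 1) →
        chi t = 1)
    (hrat' : ∀ t : torusT' (PlaneData.ofLinesRow (cmQuad ω h) a b 1),
      (t : GA (PlaneData.ofLinesRow (cmQuad ω h) a b 1)) ∈ rationalPoints (PlaneData.ofLinesRow (cmQuad ω h) a b 1) →
        chi' t = 1)
    (hcentre : ∀ (z : GA (PlaneData.ofLinesRow (cmQuad ω h) a b 1))
      (hz : z ∈ centre (PlaneData.ofLinesRow (cmQuad ω h) a b 1)),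
      chi ⟨z, centre_le_torusT _ hz⟩ = chi' ⟨z, centre_le_torusT' _ hz⟩)
    (hc : Continuous chi) (hu : ∀ x, ‖chi x‖ = 1) (hc' : Continuous chi') (hu' : ∀ x, ‖chi' x‖ = 1) :
    haveI := ofCharacters_μT_isHaarMeasure (PlaneData.ofLinesRow (cmQuad ω h) a b 1)
      (isDefinite_isGenuineRow_ofLinesRow_cmQuad ω hω h a b ha hb σ hpos).1
      (isDefinite_isGenuineRow_ofLinesRow_cmQuad ω hω h a b ha hb σ hpos).2 chi chi' hmul hmul' hrat hrat' hcentre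
    haveI := ofCharacters_μT'_isHaarMeasure (PlaneData.ofLinesRow (cmQuad ω h) a b 1)
      (isDefinite_isGenuineRow_ofLinesRow_cmQuad ω hω h a b ha hb σ hpos).1
      (isDefinite_isGenuineRow_ofLinesRow_cmQuad ω hω h a b ha hb σ hpos).2 chi chi' hmul hmul' hrat hrat' hcentre
    ∃ (DG : Set (GA (PlaneData.ofLinesRow (cmQuad ω h) a b 1)))
      (fdG : IsFundamentalDomain (rationalPoints (PlaneData.ofLinesRow (cmQuad ω h) a b 1)) DG μ)
      (compG : IsCompact (closure DG))
      (τ : ℕ → Set (GA (PlaneData.ofLinesRow (cmQuad ω h) a b 1) → ℂ))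
      (φ : ℕ → GA (PlaneData.ofLinesRow (cmQuad ω h) a b 1) → ℂ) (n : ℕ → ℕ)
      (f₁ : GA (PlaneData.ofLinesRow (cmQuad ω h) a b 1) → ℂ) (m : ℕ),
      (Setting.ofAdelicData (PlaneData.ofLinesRow (cmQuad ω h) a b 1)
        (RTFData.ofCharacters (PlaneData.ofLinesRow (cmQuad ω h) a b 1)
          (isDefinite_isGenuineRow_ofLinesRow_cmQuad ω hω h a b ha hb σ hpos).1
          (isDefinite_isGenuineRow_ofLinesRow_cmQuad ω hω h a b ha hb σ hpos).2 chi chi' hmul hmul' hrat hrat' hcentre)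
        μ DG fdG compG
        (ofCharacters_hT _ (isDefinite_isGenuineRow_ofLinesRow_cmQuad ω hω h a b ha hb σ hpos).1
          (isDefinite_isGenuineRow_ofLinesRow_cmQuad ω hω h a b ha hb σ hpos).2 chi chi' hmul hmul' hrat hrat' hcentre)
        (ofCharacters_hT' _ (isDefinite_isGenuineRow_ofLinesRow_cmQuad ω hω h a b ha hb σ hpos).1
          (isDefinite_isGenuineRow_ofLinesRow_cmQuad ω hω h a b ha hb σ hpos).2 chi chi' hmul hmul' hrat hrat'
          hcentre)).IsAdaptedONB τ φ n ∧
      RTF.IsTest f₁ ∧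
      (Setting.ofAdelicData (PlaneData.ofLinesRow (cmQuad ω h) a b 1)
        (RTFData.ofCharacters (PlaneData.ofLinesRow (cmQuad ω h) a b 1)
          (isDefinite_isGenuineRow_ofLinesRow_cmQuad ω hω h a b ha hb σ hpos).1
          (isDefinite_isGenuineRow_ofLinesRow_cmQuad ω hω h a b ha hb σ hpos).2 chi chi' hmul hmul' hrat hrat' hcentre)
        μ DG fdG compG
        (ofCharacters_hT _ (isDefinite_isGenuineRow_ofLinesRow_cmQuad ω hω h a b ha hb σ hpos).1
          (isDefinite_isGenuineRow_ofLinesRow_cmQuad ω hω h a b ha hb σ hpos).2 chi chi' hmul hmul' hrat hrat' hcentre)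
        (ofCharacters_hT' _ (isDefinite_isGenuineRow_ofLinesRow_cmQuad ω hω h a b ha hb σ hpos).1
          (isDefinite_isGenuineRow_ofLinesRow_cmQuad ω hω h a b ha hb σ hpos).2 chi chi' hmul hmul' hrat hrat'
          hcentre)).PeriodNonzeroT chi (τ m) ∧
      (Setting.ofAdelicData (PlaneData.ofLinesRow (cmQuad ω h) a b 1)
        (RTFData.ofCharacters (PlaneData.ofLinesRow (cmQuad ω h) a b 1)
          (isDefinite_isGenuineRow_ofLinesRow_cmQuad ω hω h a b ha hb σ hpos).1
          (isDefinite_isGenuineRow_ofLinesRow_cmQuad ω hω h a b ha hb σ hpos).2 chi chi' hmul hmul' hrat hrat' hcentre)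
        μ DG fdG compG
        (ofCharacters_hT _ (isDefinite_isGenuineRow_ofLinesRow_cmQuad ω hω h a b ha hb σ hpos).1
          (isDefinite_isGenuineRow_ofLinesRow_cmQuad ω hω h a b ha hb σ hpos).2 chi chi' hmul hmul' hrat hrat' hcentre)
        (ofCharacters_hT' _ (isDefinite_isGenuineRow_ofLinesRow_cmQuad ω hω h a b ha hb σ hpos).1
          (isDefinite_isGenuineRow_ofLinesRow_cmQuad ω hω h a b ha hb σ hpos).2 chi chi' hmul hmul' hrat hrat'
          hcentre)).PeriodNonzeroT' chi' (τ m) ∧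
      (Setting.ofAdelicData (PlaneData.ofLinesRow (cmQuad ω h) a b 1)
        (RTFData.ofCharacters (PlaneData.ofLinesRow (cmQuad ω h) a b 1)
          (isDefinite_isGenuineRow_ofLinesRow_cmQuad ω hω h a b ha hb σ hpos).1
          (isDefinite_isGenuineRow_ofLinesRow_cmQuad ω hω h a b ha hb σ hpos).2 chi chi' hmul hmul' hrat hrat' hcentre)
        μ DG fdG compG
        (ofCharacters_hT _ (isDefinite_isGenuineRow_ofLinesRow_cmQuad ω hω h a b ha hb σ hpos).1
          (isDefinite_isGenuineRow_ofLinesRow_cmQuad ω hω h a b ha hb σ hpos).2 chi chi' hmul hmul' hrat hrat' hcentre)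
        (ofCharacters_hT' _ (isDefinite_isGenuineRow_ofLinesRow_cmQuad ω hω h a b ha hb σ hpos).1
          (isDefinite_isGenuineRow_ofLinesRow_cmQuad ω hω h a b ha hb σ hpos).2 chi chi' hmul hmul' hrat hrat'
          hcentre)).Hit (RTF.cj f₁) (τ m) :=
  exists_periods_ofCharacters (PlaneData.ofLinesRow (cmQuad ω h) a b 1)
    (isDefinite_isGenuineRow_ofLinesRow_cmQuad ω hω h a b ha hb σ hpos).1
    (isDefinite_isGenuineRow_ofLinesRow_cmQuad ω hω h a b ha hb σ hpos).2 μ chi chi' hmul hmul' hrat hrat' hcentre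
    hc hu hc' hu'

end CMByName

end Summit.Ventures.HodgeRepro.Tier4.Line1

end
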